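import Literature.NumberTheory.QuadraticFields.LenstraPomeranceAmbiguousFormsFamilies
import Mathlib.Tactic
import HarnessLib

/-!
# Ambiguous reduced forms: counting the pairs `(A, C)` with `A(4C - A) = D`, `gcd(A, C) = 1`, `A < 2C`

Continuation of `LenstraPomeranceAmbiguousFormsFamilies`: the set
`W(D) = {(A, C) : A(4C - A) = D, gcd(A, C) = 1, 0 < A < 2C}` (which counts the reduced forms
`(a, a, c)` and `(a, b, a)` of discriminant `-D`, loc. cit.) is in bijection with the coprime
factorizations `d₀ d₁` (`d₀ < d₁`) of

* `D` itself if `D ≡ 3 (mod 4)` (`(A, C) ↦ (A, 4C - A)`),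
* `M` if `D = 4M`, `M ≡ 1 (mod 4)` (`(A, C) ↦ (A/2, 2C - A/2)`),
* `M` if `D = 16M`, `M` even (`(A, C) ↦ (A/4, C - A/4)`),

and is empty if `D ≡ 12 (mod 16)`, `D ≡ 8 (mod 16)` or `D ≡ 16 (mod 32)`. Elementary (parities and
residues mod `4`); this is the computation behind Lenstra–Pomerance 1992, Theorem 2.5
[LP92, p. 488: "a classical result, which is proved by a straightforward computation"].
Everything is proved; no definitions, no named facts.
-/

namespace Literature.NumberTheory.QuadraticFields.BinaryQuadraticForm

open Finset

/-! ### Residues mod 4 -/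

/-- `d₀ d₁ ≡ 3 (mod 4) ⟹ d₀ + d₁ ≡ 0 (mod 4)`. [folklore] -/
theorem add_mod_four_of_mul_mod_four_eq_three {d₀ d₁ : ℕ} (h : d₀ * d₁ % 4 = 3) :
    (d₀ + d₁) % 4 = 0 := by
  have key : ∀ r < 4, ∀ s < 4, r * s % 4 = 3 → (r + s) % 4 = 0 := by decide
  rw [Nat.add_mod]
  exact key _ (Nat.mod_lt _ (by norm_num)) _ (Nat.mod_lt _ (by norm_num)) (by rwa [← Nat.mul_mod])

/-- `d₀ d₁ ≡ 1 (mod 4) ⟹ d₀ + d₁ ≡ 2 (mod 4)`. [folklore] -/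
theorem add_mod_four_of_mul_mod_four_eq_one {d₀ d₁ : ℕ} (h : d₀ * d₁ % 4 = 1) :
    (d₀ + d₁) % 4 = 2 := by
  have key : ∀ r < 4, ∀ s < 4, r * s % 4 = 1 → (r + s) % 4 = 2 := by decide
  rw [Nat.add_mod]
  exact key _ (Nat.mod_lt _ (by norm_num)) _ (Nat.mod_lt _ (by norm_num)) (by rwa [← Nat.mul_mod])

/-- `a + e ≡ 2 (mod 4) ⟹ a e ≢ 3 (mod 4)`. [folklore] -/
theorem mul_mod_four_ne_three {a e : ℕ} (h : (a + e) % 4 = 2) : a * e % 4 ≠ 3 := by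
  have key : ∀ r < 4, ∀ s < 4, (r + s) % 4 = 2 → r * s % 4 ≠ 3 := by decide
  rw [Nat.mul_mod]
  exact key _ (Nat.mod_lt _ (by norm_num)) _ (Nat.mod_lt _ (by norm_num)) (by rwa [← Nat.add_mod])

/-- `a + e` even ⟹ `a e ≢ 2 (mod 4)`. [folklore] -/
theorem mul_mod_four_ne_two {a e : ℕ} (h : (a + e) % 2 = 0) : a * e % 4 ≠ 2 := by
  have key : ∀ r < 4, ∀ s < 4, (r + s) % 2 = 0 → r * s % 4 ≠ 2 := by decide
  rw [Nat.mul_mod]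
  refine key _ (Nat.mod_lt _ (by norm_num)) _ (Nat.mod_lt _ (by norm_num)) ?_
  have : (a + e) % 4 % 2 = 0 := by rw [Nat.mod_mod_of_dvd _ (by norm_num : 2 ∣ 4)]; exact h
  rw [Nat.add_mod] at this
  omega

/-! ### Parity of `A` -/

/-- If `A(4C - A) = D` with `A < 2C` and `D` even, then `A = 2α` is even and `4α(2C - α) = D`.
[folklore] -/
theorem even_of_mem_ambPairs {A C D : ℕ} (h : A * (4 * C - A) = D) (hlt : A < 2 * C)
    (hD : 2 ∣ D) : A % 2 = 0 ∧ 4 * (A / 2 * (2 * C - A / 2)) = D := by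
  have hA : A % 2 = 0 := by
    by_contra hodd
    have h1 : Odd A := Nat.odd_iff.2 (by omega)
    have h2 : Odd (4 * C - A) := Nat.odd_iff.2 (by omega)
    have h3 : Odd D := h ▸ Nat.odd_mul.2 ⟨h1, h2⟩
    rw [Nat.odd_iff] at h3
    omega
  refine ⟨hA, ?_⟩
  have h1 : A = 2 * (A / 2) := by omega
  have h2 : 4 * C - A = 2 * (2 * C - A / 2) := by omega
  rw [← h, h2]
  nth_rw 3 [h1]
  ring

/-- If `A(4C - A) = 16M` with `A < 2C`, then `A = 4α'` and `α'(C - α') = M`. [folklore] -/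
theorem four_dvd_of_mem_ambPairs {A C M : ℕ} (h : A * (4 * C - A) = 16 * M) (hlt : A < 2 * C) :
    A % 4 = 0 ∧ A / 4 * (C - A / 4) = M := by
  obtain ⟨hA2, h2⟩ := even_of_mem_ambPairs h hlt ⟨8 * M, by ring⟩
  have h3 : A / 2 * (2 * C - A / 2) = 4 * M := by omega
  have hα : A / 2 % 2 = 0 := by
    by_contra hodd
    have h4 : Odd (A / 2) := Nat.odd_iff.2 (by omega)
    have h5 : Odd (2 * C - A / 2) := Nat.odd_iff.2 (by omega)
    have h6 : Odd (4 * M) := h3 ▸ Nat.odd_mul.2 ⟨h4, h5⟩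
    rw [Nat.odd_iff] at h6
    omega
  refine ⟨by omega, ?_⟩
  have h7 : A / 2 = 2 * (A / 4) := by omega
  have h8 : 2 * C - A / 2 = 2 * (C - A / 4) := by omega
  have h9 : 2 * (A / 4) * (2 * (C - A / 4)) = 4 * M := by rw [← h7, ← h8]; exact h3
  have h10 : 4 * (A / 4 * (C - A / 4)) = 4 * M := by rw [← h9]; ring
  omega

/-! ### `D ≡ 3 (mod 4)` -/

/-- **`D ≡ 3 (mod 4)`: `W(D)` ↔ coprime factorizations `D = d₀ d₁`, `d₀ < d₁`**, via
`(A, C) ↦ (A, 4C - A)`, inverse `(d₀, d₁) ↦ (d₀, (d₀ + d₁)/4)`.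
[cite: LenstraPomerance1992, §2 Theorem 2.5] -/
theorem card_ambPairs_of_mod_four_eq_three {D : ℕ} (hD : D % 4 = 3) :
    #{x ∈ Icc 1 D ×ˢ Icc 1 D | x.1 < 2 * x.2 ∧ x.1 * (4 * x.2 - x.1) = D ∧ Nat.Coprime x.1 x.2} =
      #{x ∈ D.divisorsAntidiagonal | Nat.Coprime x.1 x.2 ∧ x.1 < x.2} := by
  have hD0 : 0 < D := by omega
  refine Finset.card_nbij' (fun x => (x.1, 4 * x.2 - x.1)) (fun y => (y.1, (y.1 + y.2) / 4))
    ?_ ?_ ?_ ?_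
  · rintro ⟨A, C⟩ hx
    rw [Finset.mem_coe, mem_ambPairs_iff hD0] at hx
    obtain ⟨hlt, heq, hcop⟩ := hx
    simp only at hlt heq hcop
    rw [Finset.mem_coe, Finset.mem_filter, Nat.mem_divisorsAntidiagonal]
    refine ⟨⟨heq, hD0.ne'⟩, ?_, by simp only; omega⟩
    simp only
    have hoddD : Odd (A * (4 * C - A)) := by rw [heq]; exact Nat.odd_iff.2 (by omega)
    have hodd : Odd A := (Nat.odd_mul.1 hoddD).1
    have h2 : Nat.Coprime A 2 :=
      Nat.coprime_comm.1 ((Nat.prime_two.coprime_iff_not_dvd).2 (by rw [Nat.odd_iff] at hodd; omega))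
    have h4C : Nat.Coprime A (4 * C) := Nat.Coprime.mul_right (h2.pow_right 2) hcop
    have hsum : 4 * C = A + (4 * C - A) := by omega
    rw [hsum] at h4C
    exact Nat.coprime_self_add_right.1 h4C
  · rintro ⟨d₀, d₁⟩ hy
    rw [Finset.mem_coe, Finset.mem_filter, Nat.mem_divisorsAntidiagonal] at hy
    obtain ⟨⟨hprod, -⟩, hcop, hlt⟩ := hy
    simp only at hprod hcop hlt
    have h4 : (d₀ + d₁) % 4 = 0 := add_mod_four_of_mul_mod_four_eq_three (by rw [hprod, hD])
    rw [Finset.mem_coe, mem_ambPairs_iff hD0]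
    simp only
    refine ⟨by omega, ?_, ?_⟩
    · have : 4 * ((d₀ + d₁) / 4) - d₀ = d₁ := by omega
      rw [this, hprod]
    · exact Nat.Coprime.coprime_dvd_right (Nat.div_dvd_of_dvd (Nat.dvd_of_mod_eq_zero h4))
        (Nat.coprime_self_add_right.2 hcop)
  · rintro ⟨A, C⟩ hx
    rw [Finset.mem_coe, mem_ambPairs_iff hD0] at hx
    obtain ⟨hlt, -, -⟩ := hx
    simp only at hlt ⊢
    ext
    · rfl
    · simp only; omega
  · rintro ⟨d₀, d₁⟩ hy
    rw [Finset.mem_coe, Finset.mem_filter, Nat.mem_divisorsAntidiagonal] at hy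
    obtain ⟨⟨hprod, -⟩, -, -⟩ := hy
    simp only at hprod
    have h4 : (d₀ + d₁) % 4 = 0 := add_mod_four_of_mul_mod_four_eq_three (by rw [hprod, hD])
    ext
    · rfl
    · simp only; omega

/-! ### `D = 4M`, `M ≡ 1 (mod 4)` -/

/-- **`D = 4M`, `M ≡ 1 (mod 4)`: `W(D)` ↔ coprime factorizations `M = d₀ d₁`, `d₀ < d₁`**, via
`(A, C) ↦ (A/2, 2C - A/2)`, inverse `(d₀, d₁) ↦ (2d₀, (d₀ + d₁)/2)`.
[cite: LenstraPomerance1992, §2 Theorem 2.5] -/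
theorem card_ambPairs_four_mul {M : ℕ} (hM : M % 4 = 1) :
    #{x ∈ Icc 1 (4 * M) ×ˢ Icc 1 (4 * M) | x.1 < 2 * x.2 ∧ x.1 * (4 * x.2 - x.1) = 4 * M ∧
        Nat.Coprime x.1 x.2} =
      #{x ∈ M.divisorsAntidiagonal | Nat.Coprime x.1 x.2 ∧ x.1 < x.2} := by
  have hM0 : 0 < M := by omega
  have hD0 : 0 < 4 * M := by omega
  refine Finset.card_nbij' (fun x => (x.1 / 2, 2 * x.2 - x.1 / 2))
    (fun y => (2 * y.1, (y.1 + y.2) / 2)) ?_ ?_ ?_ ?_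
  · rintro ⟨A, C⟩ hx
    rw [Finset.mem_coe, mem_ambPairs_iff hD0] at hx
    obtain ⟨hlt, heq, hcop⟩ := hx
    simp only at hlt heq hcop
    obtain ⟨hA2, h2⟩ := even_of_mem_ambPairs heq hlt ⟨2 * M, by ring⟩
    have h3 : A / 2 * (2 * C - A / 2) = M := by omega
    rw [Finset.mem_coe, Finset.mem_filter, Nat.mem_divisorsAntidiagonal]
    refine ⟨⟨h3, hM0.ne'⟩, ?_, by simp only; omega⟩
    simp only
    have hoddM : Odd (A / 2 * (2 * C - A / 2)) := by rw [h3]; exact Nat.odd_iff.2 (by omega)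
    have hodd : Odd (A / 2) := (Nat.odd_mul.1 hoddM).1
    have hc2 : Nat.Coprime (A / 2) 2 :=
      Nat.coprime_comm.1 ((Nat.prime_two.coprime_iff_not_dvd).2 (by rw [Nat.odd_iff] at hodd; omega))
    have hA : A = 2 * (A / 2) := by omega
    rw [hA] at hcop
    have h2C : Nat.Coprime (A / 2) (2 * C) := Nat.Coprime.mul_right hc2 hcop.coprime_mul_left
    have hsum : 2 * C = A / 2 + (2 * C - A / 2) := by omega
    rw [hsum] at h2C
    exact Nat.coprime_self_add_right.1 h2C
  · rintro ⟨d₀, d₁⟩ hy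
    rw [Finset.mem_coe, Finset.mem_filter, Nat.mem_divisorsAntidiagonal] at hy
    obtain ⟨⟨hprod, -⟩, hcop, hlt⟩ := hy
    simp only at hprod hcop hlt
    have h4 : (d₀ + d₁) % 4 = 2 := add_mod_four_of_mul_mod_four_eq_one (by rw [hprod, hM])
    rw [Finset.mem_coe, mem_ambPairs_iff hD0]
    simp only
    refine ⟨by omega, ?_, ?_⟩
    · have : 4 * ((d₀ + d₁) / 2) - 2 * d₀ = 2 * d₁ := by omega
      rw [this, ← hprod]
      ring
    · refine Nat.Coprime.mul_left ((Nat.prime_two.coprime_iff_not_dvd).2 (by omega)) ?_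
      exact Nat.Coprime.coprime_dvd_right ⟨2, by omega⟩ (Nat.coprime_self_add_right.2 hcop)
  · rintro ⟨A, C⟩ hx
    rw [Finset.mem_coe, mem_ambPairs_iff hD0] at hx
    obtain ⟨hlt, heq, -⟩ := hx
    simp only at hlt heq ⊢
    obtain ⟨hA2, -⟩ := even_of_mem_ambPairs heq hlt ⟨2 * M, by ring⟩
    ext
    · simp only; omega
    · simp only; omega
  · rintro ⟨d₀, d₁⟩ hy
    rw [Finset.mem_coe, Finset.mem_filter, Nat.mem_divisorsAntidiagonal] at hy
    obtain ⟨⟨hprod, -⟩, -, -⟩ := hy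
    simp only at hprod
    have h4 : (d₀ + d₁) % 4 = 2 := add_mod_four_of_mul_mod_four_eq_one (by rw [hprod, hM])
    ext
    · simp only; omega
    · simp only; omega

/-! ### `D = 16M`, `M` even -/

/-- **`D = 16M`, `M > 0` even: `W(D)` ↔ coprime factorizations `M = d₀ d₁`, `d₀ < d₁`**, via
`(A, C) ↦ (A/4, C - A/4)`, inverse `(d₀, d₁) ↦ (4d₀, d₀ + d₁)`.
[cite: LenstraPomerance1992, §2 Theorem 2.5] -/
theorem card_ambPairs_sixteen_mul {M : ℕ} (hM0 : 0 < M) (hM : 2 ∣ M) :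
    #{x ∈ Icc 1 (16 * M) ×ˢ Icc 1 (16 * M) | x.1 < 2 * x.2 ∧ x.1 * (4 * x.2 - x.1) = 16 * M ∧
        Nat.Coprime x.1 x.2} =
      #{x ∈ M.divisorsAntidiagonal | Nat.Coprime x.1 x.2 ∧ x.1 < x.2} := by
  have hD0 : 0 < 16 * M := by omega
  refine Finset.card_nbij' (fun x => (x.1 / 4, x.2 - x.1 / 4))
    (fun y => (4 * y.1, y.1 + y.2)) ?_ ?_ ?_ ?_
  · rintro ⟨A, C⟩ hx
    rw [Finset.mem_coe, mem_ambPairs_iff hD0] at hx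
    obtain ⟨hlt, heq, hcop⟩ := hx
    simp only at hlt heq hcop
    obtain ⟨hA4, h3⟩ := four_dvd_of_mem_ambPairs heq hlt
    rw [Finset.mem_coe, Finset.mem_filter, Nat.mem_divisorsAntidiagonal]
    refine ⟨⟨h3, hM0.ne'⟩, ?_, by simp only; omega⟩
    simp only
    have hA : A = 4 * (A / 4) := by omega
    rw [hA] at hcop
    have hC : C = A / 4 + (C - A / 4) := by omega
    have h1 : Nat.Coprime (A / 4) C := hcop.coprime_mul_left
    rw [hC] at h1
    exact Nat.coprime_self_add_right.1 h1
  · rintro ⟨d₀, d₁⟩ hy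
    rw [Finset.mem_coe, Finset.mem_filter, Nat.mem_divisorsAntidiagonal] at hy
    obtain ⟨⟨hprod, -⟩, hcop, hlt⟩ := hy
    simp only at hprod hcop hlt
    have hodd : (d₀ + d₁) % 2 = 1 := by
      have h2 : 2 ∣ d₀ * d₁ := hprod ▸ hM
      rcases (Nat.prime_two.dvd_mul).1 h2 with h | h
      · have : ¬ 2 ∣ d₁ := fun h' => by
          have := Nat.dvd_gcd h h'
          rw [hcop] at this
          omega
        omega
      · have : ¬ 2 ∣ d₀ := fun h' => by
          have := Nat.dvd_gcd h' h
          rw [hcop] at this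
          omega
        omega
    rw [Finset.mem_coe, mem_ambPairs_iff hD0]
    simp only
    refine ⟨by omega, ?_, ?_⟩
    · have : 4 * (d₀ + d₁) - 4 * d₀ = 4 * d₁ := by omega
      rw [this, ← hprod]
      ring
    · refine Nat.Coprime.mul_left ?_ (Nat.coprime_self_add_right.2 hcop)
      exact Nat.Coprime.pow_left 2 ((Nat.prime_two.coprime_iff_not_dvd).2 (by omega))
  · rintro ⟨A, C⟩ hx
    rw [Finset.mem_coe, mem_ambPairs_iff hD0] at hx
    obtain ⟨hlt, heq, -⟩ := hx
    simp only at hlt heq ⊢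
    obtain ⟨hA4, -⟩ := four_dvd_of_mem_ambPairs heq hlt
    ext
    · simp only; omega
    · simp only; omega
  · rintro ⟨d₀, d₁⟩ -
    ext
    · simp only; omega
    · simp only; omega

/-! ### The empty cases -/

/-- **`D ≡ 12 (mod 16)` (`D = 4M`, `M ≡ 3 (mod 4)`): `W(D) = ∅`.**
[cite: LenstraPomerance1992, §2 Theorem 2.5] -/
theorem ambPairs_eq_empty_of_mod_sixteen_eq_twelve {D : ℕ} (hD : D % 16 = 12) :
    {x ∈ Icc 1 D ×ˢ Icc 1 D | x.1 < 2 * x.2 ∧ x.1 * (4 * x.2 - x.1) = D ∧ Nat.Coprime x.1 x.2}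
      = ∅ := by
  have hD0 : 0 < D := by omega
  refine Finset.eq_empty_of_forall_notMem ?_
  rintro ⟨A, C⟩ hx
  rw [mem_ambPairs_iff hD0] at hx
  obtain ⟨hlt, heq, hcop⟩ := hx
  simp only at hlt heq hcop
  obtain ⟨hA2, h2⟩ := even_of_mem_ambPairs heq hlt ⟨D / 2, by omega⟩
  have h3 : A / 2 * (2 * C - A / 2) % 4 = 3 := by omega
  have hoddP : Odd (A / 2 * (2 * C - A / 2)) := Nat.odd_iff.2 (by omega)
  have hodd : Odd (A / 2) := (Nat.odd_mul.1 hoddP).1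
  have hA : A = 2 * (A / 2) := by omega
  rw [hA] at hcop
  have hC : ¬ 2 ∣ C := (Nat.prime_two.coprime_iff_not_dvd).1 hcop.coprime_mul_right
  rw [Nat.odd_iff] at hodd
  exact mul_mod_four_ne_three (a := A / 2) (e := 2 * C - A / 2) (by omega) h3

/-- **`D ≡ 8 (mod 16)` (`D = 4M`, `M ≡ 2 (mod 4)`): `W(D) = ∅`.**
[cite: LenstraPomerance1992, §2 Theorem 2.5] -/
theorem ambPairs_eq_empty_of_mod_sixteen_eq_eight {D : ℕ} (hD : D % 16 = 8) :
    {x ∈ Icc 1 D ×ˢ Icc 1 D | x.1 < 2 * x.2 ∧ x.1 * (4 * x.2 - x.1) = D ∧ Nat.Coprime x.1 x.2}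
      = ∅ := by
  have hD0 : 0 < D := by omega
  refine Finset.eq_empty_of_forall_notMem ?_
  rintro ⟨A, C⟩ hx
  rw [mem_ambPairs_iff hD0] at hx
  obtain ⟨hlt, heq, -⟩ := hx
  simp only at hlt heq
  obtain ⟨hA2, h2⟩ := even_of_mem_ambPairs heq hlt ⟨D / 2, by omega⟩
  have h3 : A / 2 * (2 * C - A / 2) % 4 = 2 := by omega
  exact mul_mod_four_ne_two (a := A / 2) (e := 2 * C - A / 2) (by omega) h3

/-- **`D ≡ 16 (mod 32)` (`D = 16M'`, `M'` odd): `W(D) = ∅`.**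
[cite: LenstraPomerance1992, §2 Theorem 2.5] -/
theorem ambPairs_eq_empty_of_mod_thirtytwo_eq_sixteen {D : ℕ} (hD : D % 32 = 16) :
    {x ∈ Icc 1 D ×ˢ Icc 1 D | x.1 < 2 * x.2 ∧ x.1 * (4 * x.2 - x.1) = D ∧ Nat.Coprime x.1 x.2}
      = ∅ := by
  have hD0 : 0 < D := by omega
  refine Finset.eq_empty_of_forall_notMem ?_
  rintro ⟨A, C⟩ hx
  rw [mem_ambPairs_iff hD0] at hx
  obtain ⟨hlt, heq, hcop⟩ := hx
  simp only at hlt heq hcop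
  have hD16 : D = 16 * (D / 16) := by omega
  rw [hD16] at heq
  obtain ⟨hA4, h3⟩ := four_dvd_of_mem_ambPairs heq hlt
  have hodd : Odd (A / 4 * (C - A / 4)) := by rw [h3]; exact Nat.odd_iff.2 (by omega)
  obtain ⟨h1, h2⟩ := Nat.odd_mul.1 hodd
  rw [Nat.odd_iff] at h1 h2
  have hC : C % 2 = 0 := by omega
  have hA : A = 4 * (A / 4) := by omega
  rw [hA] at hcop
  have h4C : Nat.Coprime 4 C := hcop.coprime_mul_right
  have h2C : Nat.Coprime 2 C := h4C.coprime_dvd_left ⟨2, rfl⟩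
  exact (Nat.prime_two.coprime_iff_not_dvd).1 h2C (Nat.dvd_of_mod_eq_zero hC)

end Literature.NumberTheory.QuadraticFields.BinaryQuadraticForm
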